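import Mathlib
import Summits.ResolutionOfSingularities.ResolutionOfSingularities.Theorems.WeightedInvariantLocalWeightedDropPolyDescentBridgeExits
import Summits.ResolutionOfSingularities.ResolutionOfSingularities.Theorems.WeightedInvariantLocalWeightedDropPolyDescentBridgeSlices
import Summits.ResolutionOfSingularities.ResolutionOfSingularities.Theorems.WeightedInvariantLocalWeightedDropPolyDescentShearBeta
import Summits.ResolutionOfSingularities.ResolutionOfSingularities.Theorems.WeightedInvariantLocalWeightedDropPolyDescentShiftAlgebra
import Summits.ResolutionOfSingularities.ResolutionOfSingularities.Theorems.WeightedInvariantLocalWeightedDropMonicPointBlowupSlot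
import Summits.ResolutionOfSingularities.ResolutionOfSingularities.Theorems.WeightedInvariantLocalWeightedDropMonicCurveBlowup

/-!
# `WeightedInvariant.LocalWeightedDrop`, stub S3ρ, line «monic polyhedron descent», piece (ρ-B): THE GAME BRIDGE T-6′_d —
# `PolyDescent.stub_polyBridge`

Crux item stmt-ResolutionOfSingularities-8899 `LocalWeightedDrop` (route `ResolutionOfSingularities/WeightedInvariant`), engine skeleton v30, stub
S3ρ `stub_wildMonicSurfaceReductionWon`; line file `L/res-L1-w43-lead-1/g3/poly_descent_line_v1.lean` (905148e143a15d9b): the sub-stub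
**(ρ-B) `PolyDescent.stub_polyBridge`, SIGNATURE VERBATIM**, sorry-free.  [OURS · L1 W4.3, chain w43; res-D-pv-058 (acting as res-L1-w43-stub-6),
with res-type-061's slice identifications `…PolyDescentBridgeSlices` (B-i), the axis-vertex lemma `…PolyDescentAxisVertex` (B-ii) and the exits
`…PolyDescentBridgeExits` (B-iii); bricks: `won_monic_of_pointBlowup_slot`, `won_monic_of_curveBlowup` (083 / stub worker 3), free moves
`WildMonic.won_monic_recentre_iff` / `won_monic_substX_iff`, lead-1's `…PolyDescent{Defs,Newton,NewtonTwo,Compare,ShearBeta,ShiftAlgebra}`.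
MODEL: the pure bridge `PureDescent.won_of_succ` (p508296) — Cossart–Jannsen–Saito's strategy Σ** read as moves of the local weighted resolution
game.  Nothing here is a statement of any manuscript; no definitions.]

* `won_monic_of_wellPrepared` — THE DISPATCH at a well-prepared label `L`: not singular ⇒ won outright; empty Newton set ⇒ `L = 0`, the germ is
  `y^d`, won in one move; a position ⇒ the supplied win (induction hypothesis); not a position ⇒ the exit `won_monic_of_wellPrepared_of_not_isPosT`;
* `coeff_single_one_eq_zero_of_isPosT_shift` — a re-centring between two positions has no linear part (so its `u₁`-chart transform
  `blowOne 1 χ` fixes the origin);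
* `stub_polyBridge` — T-6′_d: (a′) `V(y,u₁)` / `V(y,u₂)` permissible ⇒ curve blow-up (`won_monic_of_curveBlowup`, successor ↔ `divOneT`/`divTwoT`
  by `won_curveSucc_zero/one_iff`); (a″) a graph curve ⇒ shear + prepare are free moves, `V(y,ũ₂)` is permissible for the PREPARED label by
  ROW TRANSFER, then the curve blow-up; (b) the point blow-up with one slot per exceptional point (`won_monic_of_pointBlowup_slot`; slot `0` ↔
  `blowOneT (shearT λ A)` ↔ (re-centring commutes with the chart, `blowOneT_shift`) `blowOneT (prep (shearT λ A))`; slot `1` at `c₀ = 0` ↔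
  `blowTwoT A`), every successor dispatched by `won_monic_of_wellPrepared` (well-preparedness from lead-1's transports).
-/

set_option linter.dupNamespace false -- mandated namespace of this single-conjunct summit

noncomputable section

namespace Summit.ResolutionOfSingularities.ResolutionOfSingularities.Theorems

namespace PolyDescent

open MvPowerSeries MonicDescent WildMonic Literature.AlgebraicGeometry.Resolution
  Literature.AlgebraicGeometry.Resolution.CobordantGame WildPurePower

variable {k : Type} [Field k]

/-! ## Small tuple facts -/

/-- A tuple with empty scaled Newton set is zero. -/
theorem eq_zero_of_newtonSet_not_nonempty {d : ℕ} {L : Fin d → MvPowerSeries (Fin 2) k} (h : ¬ (newtonSet L).Nonempty) :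
    L = fun _ => 0 := by
  funext j
  ext e
  rw [map_zero]
  by_contra hne
  exact h ⟨_, j, e, hne, rfl⟩

/-- The monic germ of the zero tuple is `y^d`, won in one move. -/
theorem won_monic_zero' (d : ℕ) :
    CobordantGame.Won k (2 + 1) ((X (Fin.last 2) : MvPowerSeries (Fin (2 + 1)) k) ^ d +
      ∑ j : Fin d, rename (Fin.succAboveEmb (Fin.last 2)) ((fun _ : Fin d => (0 : MvPowerSeries (Fin 2) k)) j) * X (Fin.last 2) ^ (j : ℕ)) := by
  simp only [map_zero, zero_mul, Finset.sum_const_zero, add_zero]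
  exact won_X_pow_last 2 d

/-- `u₁^{d−j} · (A/u₁^{d−·})_j = A_j` on a `V(y,u₁)`-permissible label. -/
theorem eq_X_pow_mul_divOneT {d : ℕ} {A : Fin d → MvPowerSeries (Fin 2) k} (h : IsPermissibleOneT d A) (j : Fin d) :
    A j = (X 0 : MvPowerSeries (Fin 2) k) ^ (d - (j : ℕ)) * divOneT d A j :=
  (X_pow_mul_divOne (d - (j : ℕ)) (A j) (h j)).symm

/-- `u₂^{d−j} · (A/u₂^{d−·})_j = A_j` on a `V(y,u₂)`-permissible label. -/
theorem eq_X_pow_mul_divTwoT {d : ℕ} {A : Fin d → MvPowerSeries (Fin 2) k} (h : IsPermissibleTwoT d A) (j : Fin d) :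
    A j = (X 1 : MvPowerSeries (Fin 2) k) ^ (d - (j : ℕ)) * divTwoT d A j :=
  (X_pow_mul_divTwo (d - (j : ℕ)) (A j) (h j)).symm

/-- The curve successors of a position vanish at the origin. -/
theorem constantCoeff_divOneT_eq_zero {d : ℕ} {A : Fin d → MvPowerSeries (Fin 2) k} (hA : IsPosT d A) (j : Fin d) :
    constantCoeff (divOneT d A j) = 0 := by
  rw [← coeff_zero_eq_constantCoeff_apply, show divOneT d A j = divOne (d - (j : ℕ)) (A j) from rfl, coeff_divOne, zero_add]
  exact coeff_of_lt_order (by rw [Finsupp.degree_single]; exact hA j)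

/-- The curve successors of a position vanish at the origin (letter `u₂`). -/
theorem constantCoeff_divTwoT_eq_zero {d : ℕ} {A : Fin d → MvPowerSeries (Fin 2) k} (hA : IsPosT d A) (j : Fin d) :
    constantCoeff (divTwoT d A j) = 0 := by
  rw [← coeff_zero_eq_constantCoeff_apply, show divTwoT d A j = divTwo (d - (j : ℕ)) (A j) from rfl, coeff_divTwo, zero_add]
  exact coeff_of_lt_order (by rw [Finsupp.degree_single]; exact hA j)

/-- **A re-centring between two positions has no linear part** (`d ≥ 1`): else `(shift d Y χ)_0 ∋ c^d u_l^d`, of order `d`. -/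
theorem coeff_single_one_eq_zero_of_isPosT_shift {d : ℕ} (hd : 0 < d) {Y : Fin d → MvPowerSeries (Fin 2) k} (hY : IsPosT d Y)
    {χ : MvPowerSeries (Fin 2) k} (hχ : constantCoeff χ = 0) (hpos : IsPosT d (shift d Y χ)) (l : Fin 2) :
    coeff (Finsupp.single l 1) χ = 0 := by
  by_contra hc
  have h := (coeff_axis_shift l Y χ 1 (fun n hn => by
    have hn0 : n = 0 := by omega
    subst hn0
    rw [Finsupp.single_zero, coeff_zero_eq_constantCoeff_apply, hχ]) (fun i n hn => coeff_of_lt_order (lt_of_le_of_lt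
      (by rw [Finsupp.degree_single]; exact_mod_cast (by omega : n ≤ d - (i : ℕ))) (hY i))) ⟨0, hd⟩).2
  have hne : coeff (Finsupp.single l (1 * (d - ((⟨0, hd⟩ : Fin d) : ℕ)))) (shift d Y χ ⟨0, hd⟩) ≠ 0 := by
    rw [h, show ((⟨0, hd⟩ : Fin d) : ℕ) = 0 from rfl, Nat.choose_zero_right, Nat.cast_one, one_mul]
    exact pow_ne_zero _ hc
  have hle := order_le hne
  rw [Finsupp.degree_single] at hle
  have hlt := lt_of_lt_of_le (hpos ⟨0, hd⟩) hle
  rw [one_mul] at hlt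
  exact lt_irrefl _ hlt

/-! ## The dispatch at a well-prepared label -/

/-- **THE DISPATCH**: over `k = k̄` of characteristic `p`, given (H<d) and (Haxis), the monic germ of a WELL-PREPARED label `L` is won as soon as it is
won when `L` is a position with non-empty Newton set (the induction hypothesis of the bridge): a non-singular germ is won outright, an empty Newton
set means `L = 0` (germ `y^d`), and a non-position is the exit `won_monic_of_wellPrepared_of_not_isPosT`. -/
theorem won_monic_of_wellPrepared (p : ℕ) (hp : p.Prime) (k : Type) [Field k] [CharP k p] [IsAlgClosed k] {d : ℕ} (hd : 0 < d)
    (hord : ∀ g : MvPowerSeries (Fin 3) k, CobordantGame.IsSingular k g → g.order < d → CobordantGame.Won k 3 g)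
    (haxis : ∀ g : MvPowerSeries (Fin 3) k, CobordantGame.IsSingular k g → g.order = d →
      (∃ c : Fin 3 → k, c ≠ 0 ∧ ∀ v : Fin 3 → k,
        CobordantChart.initEval (fun _ : Fin 3 => 1) (v + c) d g = CobordantChart.initEval (fun _ : Fin 3 => 1) v d g) →
      (∀ c₁ c₂ : Fin 3 → k,
        (∀ v : Fin 3 → k, CobordantChart.initEval (fun _ : Fin 3 => 1) (v + c₁) d g = CobordantChart.initEval (fun _ : Fin 3 => 1) v d g) →
        (∀ v : Fin 3 → k, CobordantChart.initEval (fun _ : Fin 3 => 1) (v + c₂) d g = CobordantChart.initEval (fun _ : Fin 3 => 1) v d g) →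
        ∃ α β : k, (α ≠ 0 ∨ β ≠ 0) ∧ α • c₁ + β • c₂ = 0) →
      CobordantGame.Won k 3 g)
    {L : Fin d → MvPowerSeries (Fin 2) k} (hWP : WellPrepared d L)
    (IH : IsPosT d L → (newtonSet L).Nonempty →
      CobordantGame.Won k (2 + 1) ((X (Fin.last 2) : MvPowerSeries (Fin (2 + 1)) k) ^ d +
        ∑ j : Fin d, rename (Fin.succAboveEmb (Fin.last 2)) (L j) * X (Fin.last 2) ^ (j : ℕ))) :
    CobordantGame.Won k (2 + 1) ((X (Fin.last 2) : MvPowerSeries (Fin (2 + 1)) k) ^ d +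
      ∑ j : Fin d, rename (Fin.succAboveEmb (Fin.last 2)) (L j) * X (Fin.last 2) ^ (j : ℕ)) := by
  by_cases hsing : CobordantGame.IsSingular k ((X (Fin.last 2) : MvPowerSeries (Fin (2 + 1)) k) ^ d +
      ∑ j : Fin d, rename (Fin.succAboveEmb (Fin.last 2)) (L j) * X (Fin.last 2) ^ (j : ℕ))
  swap
  · exact (wonBy_zero_of_not_isSingular (Nat.succ_pos 2) hsing).won
  by_cases hne : (newtonSet L).Nonempty
  swap
  · rw [eq_zero_of_newtonSet_not_nonempty hne]
    exact won_monic_zero' d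
  by_cases hposL : IsPosT d L
  · exact IH hposL hne
  · exact won_monic_of_wellPrepared_of_not_isPosT p hp k hd hord haxis hWP hposL hsing

/-! ## The game bridge T-6′_d -/

/-- **(ρ-B) THE GAME BRIDGE T-6′_d** — `PolyDescent.stub_polyBridge` with the line file's signature VERBATIM: over an algebraically closed field of
characteristic `p`, under the hypotheses (ρ-P) (every position has a well-preparing re-centring), (H<d), (Haxis) of S3ρ, at a well-prepared position
`A` with non-empty Newton set, if every Σ**_d-successor label that is a well-prepared position with non-empty Newton set gives a won monic germ, then
the monic germ of `A` is won. -/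
theorem stub_polyBridge : ∀ (p : ℕ), p.Prime → ∀ (k : Type) [Field k] [CharP k p] [IsAlgClosed k] (d : ℕ), 2 < d →
    (∀ A : Fin d → MvPowerSeries (Fin 2) k, IsPosT d A → ∃ ψ : MvPowerSeries (Fin 2) k, IsPrepRecentring d A ψ) →
    (∀ g : MvPowerSeries (Fin 3) k, CobordantGame.IsSingular k g → g.order < d → CobordantGame.Won k 3 g) →
    (∀ g : MvPowerSeries (Fin 3) k, CobordantGame.IsSingular k g → g.order = d →
      (∃ c : Fin 3 → k, c ≠ 0 ∧ ∀ v : Fin 3 → k,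
        CobordantChart.initEval (fun _ : Fin 3 => 1) (v + c) d g = CobordantChart.initEval (fun _ : Fin 3 => 1) v d g) →
      (∀ c₁ c₂ : Fin 3 → k,
        (∀ v : Fin 3 → k, CobordantChart.initEval (fun _ : Fin 3 => 1) (v + c₁) d g = CobordantChart.initEval (fun _ : Fin 3 => 1) v d g) →
        (∀ v : Fin 3 → k, CobordantChart.initEval (fun _ : Fin 3 => 1) (v + c₂) d g = CobordantChart.initEval (fun _ : Fin 3 => 1) v d g) →
        ∃ α β : k, (α ≠ 0 ∨ β ≠ 0) ∧ α • c₁ + β • c₂ = 0) →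
      CobordantGame.Won k 3 g) →
    ∀ A : Fin d → MvPowerSeries (Fin 2) k, WellPrepared d A → IsPosT d A → (newtonSet A).Nonempty →
    (∀ A' ∈ succT d A, WellPrepared d A' → IsPosT d A' → (newtonSet A').Nonempty →
      CobordantGame.Won k (2 + 1) ((X (Fin.last 2) : MvPowerSeries (Fin (2 + 1)) k) ^ d +
        ∑ j : Fin d, rename (Fin.succAboveEmb (Fin.last 2)) (A' j) * X (Fin.last 2) ^ (j : ℕ))) →
    CobordantGame.Won k (2 + 1) ((X (Fin.last 2) : MvPowerSeries (Fin (2 + 1)) k) ^ d +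
      ∑ j : Fin d, rename (Fin.succAboveEmb (Fin.last 2)) (A j) * X (Fin.last 2) ^ (j : ℕ)) := by
  intro p hp k _ _ _ d h2d hprep hord haxis A hWP hpos _ IH
  classical
  have hd : 0 < d := by omega
  -- the dispatch at a successor label
  have dispatch : ∀ L : Fin d → MvPowerSeries (Fin 2) k, L ∈ succT d A → WellPrepared d L →
      CobordantGame.Won k (2 + 1) ((X (Fin.last 2) : MvPowerSeries (Fin (2 + 1)) k) ^ d +
        ∑ j : Fin d, rename (Fin.succAboveEmb (Fin.last 2)) (L j) * X (Fin.last 2) ^ (j : ℕ)) :=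
    fun L hL hWPL => won_monic_of_wellPrepared p hp k hd hord haxis hWPL (IH L hL hWPL)
  by_cases h1 : IsPermissibleOneT d A
  · -- (a′) the curve `V(y,u₁)`
    refine won_monic_of_curveBlowup p hp k 2 d hd 0 A (divOneT d A) (eq_X_pow_mul_divOneT h1) (constantCoeff_divOneT_eq_zero hpos)
      fun ci hci _ => ?_
    rw [won_curveSucc_zero_iff hci]
    exact dispatch _ (by rw [succT_of_isPermissibleOneT h1]; exact Set.mem_singleton _) (wellPrepared_divOneT A h1 hWP)
  by_cases h2 : IsPermissibleTwoT d A
  · -- (a′) the curve `V(y,u₂)`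
    refine won_monic_of_curveBlowup p hp k 2 d hd 1 A (divTwoT d A) (eq_X_pow_mul_divTwoT h2) (constantCoeff_divTwoT_eq_zero hpos)
      fun ci hci _ => ?_
    rw [won_curveSucc_one_iff hci]
    exact dispatch _ (by rw [succT_of_isPermissibleTwoT h1 h2]; exact Set.mem_singleton _) (wellPrepared_divTwoT A h2 hWP)
  by_cases h3 : HasGraphCurveT d A
  · -- (a″) a graph curve: shear (free), prepare (free), row transfer, then the curve `V(y, ũ₂)`
    set h := graphShearT d A with hh
    obtain ⟨ψ, -, -, hperm⟩ := graphShearT_spec h3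
    set Y := shearT h A with hY
    have hposY : IsPosT d Y := isPosT_shearT h hpos
    obtain ⟨hχ0, hposB, hWPB, -⟩ := isPrepRecentring_prepPsi (hprep Y hposY)
    set χ := prepPsi d Y with hχ
    set B := prep d Y with hB
    have hBdef : B = shift d Y χ := rfl
    -- row transfer: `V(y,ũ₂)` is permissible for the PREPARED label
    have hpermB : IsPermissibleTwoT d B := by
      refine isPermissibleTwoT_of_wellPrepared_of_isPermissibleTwoT_shift hd hWPB (φ := ψ - χ) ?_
      rw [hBdef, shift_shift, sub_add_cancel]
      exact hperm
    -- free moves `A ~ Y ~ B`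
    have hAY : CobordantGame.Won k (2 + 1) ((X (Fin.last 2) : MvPowerSeries (Fin (2 + 1)) k) ^ d +
          ∑ j : Fin d, rename (Fin.succAboveEmb (Fin.last 2)) (Y j) * X (Fin.last 2) ^ (j : ℕ)) ↔
        CobordantGame.Won k (2 + 1) ((X (Fin.last 2) : MvPowerSeries (Fin (2 + 1)) k) ^ d +
          ∑ j : Fin d, rename (Fin.succAboveEmb (Fin.last 2)) (A j) * X (Fin.last 2) ^ (j : ℕ)) := by
      have hYj : ∀ j, Y j = subst ![X 0, X 1 + X 0 * h] (A j) := fun j => by rw [hY]; exact shear_eq h (A j)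
      simp only [hYj]
      exact won_monic_substX_iff _ (constantCoeff_shearFamily h) (PureDescent.isUnit_det_shearFamily h) A
    rw [← hAY, ← won_monic_recentre_iff χ hχ0 Y, ← hBdef]
    refine won_monic_of_curveBlowup p hp k 2 d hd 1 B (divTwoT d B) (eq_X_pow_mul_divTwoT hpermB) (constantCoeff_divTwoT_eq_zero hposB)
      fun ci hci _ => ?_
    rw [won_curveSucc_one_iff hci]
    exact dispatch _ (by rw [succT_of_hasGraphCurveT h1 h2 h3]; exact Set.mem_singleton _) (wellPrepared_divTwoT B hpermB hWPB)
  -- (b) the point blow-up, one slot per exceptional point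
  have hsucc := succT_of_point h1 h2 h3
  refine won_monic_of_pointBlowup_slot p hp k 2 d hd A hpos fun c hcex Bv hBv => ?_
  by_cases hc0 : c 0 ≠ 0
  · -- slot `0`: the `u₁`-chart of the `λ`-sheared label, `λ = c₁/c₀`
    refine ⟨0, hc0, fun _ => ?_⟩
    rw [won_pointSucc_zero_iff c A Bv hBv hc0]
    by_cases hl : c 1 / c 0 = 0
    · -- `λ = 0`: the plain `u₁`-chart
      have hsh : shearT (C (c 1 / c 0)) A = A := by funext j; rw [hl, map_zero]; exact shear_zero_eq (A j)
      rw [hsh]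
      exact dispatch _ (by rw [hsucc]; exact Set.mem_union_left _ (Set.mem_insert _ _)) (wellPrepared_blowOneT A hpos hWP)
    · -- `λ ≠ 0`: prepare the sheared label (a free move commuting with the chart), then the `u₁`-chart
      set Y := shearT (C (c 1 / c 0)) A with hY
      have hposY : IsPosT d Y := isPosT_shearT _ hpos
      obtain ⟨hχ0, hposB, hWPB, -⟩ := isPrepRecentring_prepPsi (hprep Y hposY)
      set χ := prepPsi d Y with hχ
      have hBdef : prep d Y = shift d Y χ := rfl
      have hχ1 : (1 : ℕ∞) ≤ χ.order := nat_le_order fun e he => by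
        have he0 : e = 0 := by
          have : e.degree = 0 := by exact_mod_cast Nat.lt_one_iff.mp (by exact_mod_cast he)
          exact (Finsupp.degree_eq_zero_iff e).mp this
        rw [he0, coeff_zero_eq_constantCoeff_apply, hχ0]
      have hcomm : blowOneT d (prep d Y) = shift d (blowOneT d Y) (blowOne 1 χ) := by
        rw [hBdef]; exact blowOneT_shift Y χ (fun j => (hposY j).le) hχ1
      have hchi1 : constantCoeff (blowOne 1 χ) = 0 := by
        rw [constantCoeff_blowOne_one_eq]
        exact coeff_single_one_eq_zero_of_isPosT_shift hd hposY hχ0 (hBdef ▸ hposB) 0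
      rw [← won_monic_recentre_iff (blowOne 1 χ) hchi1 (blowOneT d Y), ← hcomm]
      exact dispatch _ (by rw [hsucc]; exact Set.mem_union_right _ ⟨c 1 / c 0, hl, rfl⟩)
        (wellPrepared_blowOneT _ hposB hWPB)
  · -- slot `1` at `c₀ = 0`: the `u₂`-chart
    rw [not_not] at hc0
    have hc1 : c 1 ≠ 0 := by
      obtain ⟨i, hi⟩ := hcex
      have : i = 0 ∨ i = 1 := by fin_cases i <;> simp
      rcases this with rfl | rfl
      · exact absurd hc0 hi
      · exact hi
    refine ⟨1, hc1, fun _ => ?_⟩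
    rw [won_pointSucc_one_iff c A Bv hBv hc0 hc1]
    exact dispatch _ (by rw [hsucc]; exact Set.mem_union_left _ (Set.mem_insert_of_mem _ rfl)) (wellPrepared_blowTwoT A hpos hWP)

end PolyDescent

end Summit.ResolutionOfSingularities.ResolutionOfSingularities.Theorems

end
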